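import Literature.AnabelianGeometry.SemiGraphs.QuasiTemperoidsThmA4OfEngine
import Literature.AnabelianGeometry.SemiGraphs.QuasiTemperoidsThmA4CechExtension
import Literature.AnabelianGeometry.SemiGraphs.BTempProdColimits
import Literature.AnabelianGeometry.SemiGraphs.OverPrimeDownwardClosed
import Literature.AnabelianGeometry.SemiGraphs.BTempLimitsProofs
import HarnessLib

/-!
# Semi-graphs of anabelioids, Appendix, Theorem A.4 (existence, Čech route): `ThmA4` REDUCED to the
# finite-limit clause of the Čech extension `Ψ = ψ^*`

Mochizuki, *Semi-graphs of anabelioids*, Publ. RIMS **42** (2006) 221–322, Appendix, Theorem A.4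
(manuscript pp. 82–86), proof p. 85 (PRIMS p. 315 ll. 19–24)
[cite: MochizukiSemiAnbd2006, Thm A.4 pp.82-86]: "The fact that the resulting functor `ψ^* : T₂ → T₁`
preserves countable colimits (respectively, fibered products) follows by a routine argument … Thus,
to show that `ψ` is a morphism of temperoids [i.e., that `ψ^*` preserves finite limits], it suffices to
show that `ψ^*` preserves terminal objects."

PROOF-ONLY reduction step of row **A4-∃** (`plan/L3/SUBDAG-SemiAnbd-Cor311.md`, Čech route, holder
abc-iut-w5-d129; this file abc-iut-w4-d089, the E1/E2 second reader): abc-iut-w5-d129's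
`ThmA4Chart.thmA4_of_engine'` (p419099) reduces the typed fact `ThmA4` (F-1634) to the ENGINE binder
`hE` (some `Ψ : B^temp(Π₂) ⥤ B^temp(Π₁)` preserving finite limits and countable colimits with
`F ⋙ ι₁ ≅ ι₂ ⋙ Ψ`).  With the Čech extension **`Ψ := ThmA4Cech.Ψ A₂ (F ⋙ ι₁)`** of abc-iut-L3-t5's E2
(`QuasiTemperoidsThmA4CechExtension.lean`, over abc-iut-w4-d081's `CechPresentation`), TWO of the three
conjuncts of `hE` hold outright in the tree — the isomorphism `ThmA4Cech.α` (split coequalizers, for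
every `F`) and the countable colimits `ThmA4Cech.preservesColimitsOfShape_Ψ` (inputs: abc-iut-w5-d220's
`BTemp.preservesColimitsOfShape_prodFunctor_flip_obj`, E2a, and `overPrime_ι_preservesColimitsOfShape`,
E0).  Hence:

* **`ThmA4Cech.cechEngine_of_preservesFiniteLimits`** — the engine binder `hE` of p419099 FOLLOWS from
  the single remaining clause `hE3 : PreservesFiniteLimits (ThmA4Cech.Ψ A₂ (F ⋙ ι₁))` (file E3,
  `QuasiTemperoidsThmA4CechLimits.lean`, abc-iut-w5-d129 — quantified here in exactly the shape of `hE`);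
* **`ThmA4Cech.thmA4_of_cechLimits : hE3 → ThmA4`** — F-1634 reduced to E3 alone.

CONDITIONAL on `hE3`; nothing is rounded up; E3/E4 remain the holder's files (E4 = `exact` E3 into
this reduction, or into p419099 directly).  Nothing refers to the IUT corpus; no side is taken on any
disputed claim.
-/

namespace Literature.AnabelianGeometry.SemiGraphs

namespace ThmA4Cech

open CategoryTheory CategoryTheory.Limits
open Literature.AlgebraicGeometry.Frobenioids (IsConnectedObj)

universe v₁ v₂ u u₁ u₂

/-- **The engine binder of `ThmA4Chart.thmA4_of_engine'` from the finite-limit clause of the Čech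
extension**: take `Ψ := ThmA4Cech.Ψ A₂ (F ⋙ ι₁)`; the 1-commutation is `ThmA4Cech.α` and the countable
colimits are `ThmA4Cech.preservesColimitsOfShape_Ψ` (with E2a and E0); finite limits are the
hypothesis `hE3`. [cite: MochizukiSemiAnbd2006, Thm A.4 pp.82-86] -/
theorem cechEngine_of_preservesFiniteLimits
    (hE3 : ∀ {G₁ : Type u} [Group G₁] [TopologicalSpace G₁] [IsTopologicalGroup G₁]
      {G₂ : Type u} [Group G₂] [TopologicalSpace G₂] [IsTopologicalGroup G₂]
      (_ : IsTempered G₁) (_ : IsTempered G₂)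
      {A₁ : BTemp G₁} (_ : IsConnectedObj A₁) {A₂ : BTemp G₂} (_ : IsConnectedObj A₂)
      (F : Over' A₂ ⥤ Over' A₁) (_ : PreservesFiniteLimits F)
      (_ : ∀ (J : Type) [SmallCategory J] [CountableCategory J], PreservesColimitsOfShape J F)
      (_ : ∀ X : Over' A₂, IsNondegenerateObj X → IsNondegenerateObj (F.obj X)),
      haveI := BTemp.hasFiniteLimits (G := G₂)
      haveI := BTemp.hasColimitsOfShape_of_countable (G := G₁) WalkingParallelPair
      PreservesFiniteLimits (ThmA4Cech.Ψ A₂ (F ⋙ (admitsHomTo A₁).ι)))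
    {G₁ : Type u} [Group G₁] [TopologicalSpace G₁] [IsTopologicalGroup G₁]
    {G₂ : Type u} [Group G₂] [TopologicalSpace G₂] [IsTopologicalGroup G₂]
    (hG₁ : IsTempered G₁) (hG₂ : IsTempered G₂)
    {A₁ : BTemp G₁} (hA₁ : IsConnectedObj A₁) {A₂ : BTemp G₂} (hA₂ : IsConnectedObj A₂)
    (F : Over' A₂ ⥤ Over' A₁) (hlim : PreservesFiniteLimits F)
    (hcolim : ∀ (J : Type) [SmallCategory J] [CountableCategory J], PreservesColimitsOfShape J F)
    (hnd : ∀ X : Over' A₂, IsNondegenerateObj X → IsNondegenerateObj (F.obj X)) :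
    ∃ Ψ : BTemp G₂ ⥤ BTemp G₁, PreservesFiniteLimits Ψ ∧
      (∀ (J : Type) [SmallCategory J] [CountableCategory J], PreservesColimitsOfShape J Ψ) ∧
      Nonempty (F ⋙ (admitsHomTo A₁).ι ≅ (admitsHomTo A₂).ι ⋙ Ψ) := by
  haveI := BTemp.hasFiniteLimits (G := G₂)
  haveI := BTemp.hasColimitsOfShape_of_countable (G := G₁) WalkingParallelPair
  refine ⟨ThmA4Cech.Ψ A₂ (F ⋙ (admitsHomTo A₁).ι), hE3 hG₁ hG₂ hA₁ hA₂ F hlim hcolim hnd, ?_,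
    ⟨ThmA4Cech.α A₂ _⟩⟩
  intro J _ _
  haveI := BTemp.hasColimitsOfShape_of_countable (G := G₁) J
  haveI : PreservesColimitsOfShape J (prod.functor.flip.obj A₂) :=
    BTemp.preservesColimitsOfShape_prodFunctor_flip_obj_of_countableCategory (G := G₂) A₂ J
  haveI : PreservesColimitsOfShape J F := hcolim J
  haveI : PreservesColimitsOfShape J (admitsHomTo A₁).ι :=
    overPrime_ι_preservesColimitsOfShape_of_countableCategory A₁ J
  exact ThmA4Cech.preservesColimitsOfShape_Ψ A₂ _ J

/-- **Theorem A.4 (`ThmA4`, FACT-LIST F-1634) REDUCED TO E3 ALONE**: if the Čech extension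
`Ψ = coeq(F(X × A₂ × A₂) ⇉ F(X × A₂))` preserves finite limits (for all tempered `Πᵢ`, connected `Aᵢ`,
and `F` preserving finite limits, countable colimits and nondegenerate objects), then `ThmA4` holds —
by `cechEngine_of_preservesFiniteLimits` and abc-iut-w5-d129's `ThmA4Chart.thmA4_of_engine'`.
CONDITIONAL on `hE3`. [cite: MochizukiSemiAnbd2006, Thm A.4 pp.82-86] -/
theorem thmA4_of_cechLimits
    (hE3 : ∀ {G₁ : Type u} [Group G₁] [TopologicalSpace G₁] [IsTopologicalGroup G₁]
      {G₂ : Type u} [Group G₂] [TopologicalSpace G₂] [IsTopologicalGroup G₂]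
      (_ : IsTempered G₁) (_ : IsTempered G₂)
      {A₁ : BTemp G₁} (_ : IsConnectedObj A₁) {A₂ : BTemp G₂} (_ : IsConnectedObj A₂)
      (F : Over' A₂ ⥤ Over' A₁) (_ : PreservesFiniteLimits F)
      (_ : ∀ (J : Type) [SmallCategory J] [CountableCategory J], PreservesColimitsOfShape J F)
      (_ : ∀ X : Over' A₂, IsNondegenerateObj X → IsNondegenerateObj (F.obj X)),
      haveI := BTemp.hasFiniteLimits (G := G₂)
      haveI := BTemp.hasColimitsOfShape_of_countable (G := G₁) WalkingParallelPair
      PreservesFiniteLimits (ThmA4Cech.Ψ A₂ (F ⋙ (admitsHomTo A₁).ι))) :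
    Literature.AnabelianGeometry.SemiGraphs.ThmA4.{v₁, v₂, u, u₁, u₂} :=
  ThmA4Chart.thmA4_of_engine' (by
    intro G₁ _ _ _ G₂ _ _ _ hG₁ hG₂ A₁ hA₁ A₂ hA₂ F hlim hcolim hnd
    exact cechEngine_of_preservesFiniteLimits hE3 hG₁ hG₂ hA₁ hA₂ F hlim hcolim hnd)

end ThmA4Cech

end Literature.AnabelianGeometry.SemiGraphs
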